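import Mathlib
import Summits.ResolutionOfSingularities.ResolutionOfSingularities.Theorems.HomologicalConductorNoZenoSplitChart
import HarnessLib

/-!
# D2′ PART 4d: the chart germs of `Sig.L1Core` upstairs — existence, normality, rationality, packaging

W4.4 (crux `NoZenoR`, stmt-ResolutionOfSingularities-19943), `stub_L1wCore` route (F1), descent
step (B2) of `L1W-PREP-v2.md` §2.1 (res-L0-w44-stub-2), continued from `…NoZenoSplitChart`:
for `D ≤ R ⊆ K` (`D` the germ where the splitting polynomial `f` lives, `R = nrm B` the normalised
chart ring), a prime `𝔮 ⊂ R` and the new germ `D' = R_𝔮`: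

* `exists_chartPrime_over`: a prime `𝔮_f` of `k[R ∪ {β}] = (nrm B)[β] = nrm B_f` over `𝔮` EXISTS;
* for any such `𝔮_f`, the chart germ `D'_f := (k[R ∪ {β}])_{𝔮_f}`: contains the upstairs thread germ
  `D_f` (`splitGerm_subset_chartGerm`), is a normal domain (`isIntegrallyClosed_chartGerm`), has
  `dim D'_f = dim D'` and is regular iff `D'` is (`chartGerm_bundle` of `…NoZenoSplitChart`), and is
  rational when `D'` is (`hasRationalSingularity_chartGerm`, Lipman (16.5) as a HYPOTHESIS);
* `locPrime_comap_equivOfEq`: transport of `locPrime` along an equality of subalgebras (so that a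
  consumer holding `nrm B_f = k[nrm B ∪ {β}]` from `adjoin_chart_eq`/`nrm_chart_eq` can present
  `D'_f` as `locPrime (nrm B_f) 𝔮'` verbatim, as the upstairs `Sig.L1Core` quantifies);
* the packaging `exists_chartGermData` in `Sig.L1Core`'s spelling.

OURS (cell res-hironaka, chain W4.4); AI-written, weaker than expert review; nothing here is a
statement of the manuscript under review (Hironaka 2017); no Theses file is imported.
-/

noncomputable section

set_option linter.dupNamespace false

open IsLocalRing Polynomial
open Summit.ResolutionOfSingularities.ResolutionOfSingularities.Theorems.NoZeno.SandwichCluster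
open Parasite (locPrime isLocalRing_locPrime mem_locPrime_of_mem inv_mem_locPrime_of_not_mem)
open Thread (toSubring_le_locPrime isIntegrallyClosed_locPrime)

namespace Summit.ResolutionOfSingularities.ResolutionOfSingularities.Theorems.NoZeno.SplittingBase

variable {k K : Type} [Field k] [Field K] [Algebra k K]

/-- **Transport of `locPrime` along an equality of subalgebras**: for `S = S'` and a prime `Q'`
of `S'`, `locPrime S (Q' pulled back) = locPrime S' Q'`. [this work] -/
theorem locPrime_comap_equivOfEq {L : Type} [Field L] [Algebra k L] (S S' : Subalgebra k L)
    (h : S = S') (Q' : Ideal ↥S') (hQ' : Q'.IsPrime) :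
    locPrime S (Q'.comap (Subalgebra.equivOfEq S S' h : ↥S →+* ↥S')) (Ideal.comap_isPrime _ _) =
      locPrime S' Q' hQ' := by
  subst h
  have hc : Q'.comap (Subalgebra.equivOfEq S S rfl : ↥S →+* ↥S) = Q' := by
    ext x
    rw [Ideal.mem_comap]
    rfl
  simp_rw [hc]

section ChartGerm

variable (D R : Subalgebra k K) (hDR : D ≤ R) (f : (↥D)[X])
  [Fact (Irreducible (f.map (algebraMap ↥D K)))] (𝔮 : Ideal ↥R) (h𝔮 : 𝔮.IsPrime)

include hDR h𝔮 in
/-- **A prime of `k[R ∪ {β}]` over `𝔮` exists** (`f` monic). [this work] -/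
theorem exists_chartPrime_over (hf : f.Monic) :
    ∃ (𝔮f : Ideal ↥(adjoinBeta R (f.map (algebraMap ↥D K)))) (_ : 𝔮f.IsPrime),
      ∀ r : ↥R, toAdjoinBeta R (f.map (algebraMap ↥D K)) r ∈ 𝔮f ↔ r ∈ 𝔮 := by
  haveI := h𝔮
  exact exists_adjoinBetaPrime_over R _ (f.map (Subalgebra.inclusion hDR).toRingHom)
    (map_map_inclusion D f hDR) (hf.map _) 𝔮

variable (𝔮f : Ideal ↥(adjoinBeta R (f.map (algebraMap ↥D K)))) (h𝔮f : 𝔮f.IsPrime)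
  (hover : ∀ r : ↥R, toAdjoinBeta R (f.map (algebraMap ↥D K)) r ∈ 𝔮f ↔ r ∈ 𝔮)

include hDR in
/-- **The upstairs thread germ lies in the chart germ**: `D_f = D[β] ⊆ k[R ∪ {β}] ⊆ (k[R ∪ {β}])_{𝔮_f}`.
[this work] -/
theorem splitGerm_subset_chartGerm [IsLocalRing ↥D] (hf : f.Monic) (hirr : Irreducible (f.map (residue ↥D)))
    (hPf : (splitPrime D f).IsPrime) :
    (locPrime (splitModel D f) (splitPrime D f) hPf : Set (AdjoinRoot (f.map (algebraMap ↥D K)))) ⊆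
      locPrime (adjoinBeta R (f.map (algebraMap ↥D K))) 𝔮f h𝔮f := by
  rw [locPrime_splitPrime_eq D f hf hirr hPf, Subalgebra.coe_toSubring, splitModel_eq_liftModel,
    liftModel_eq_adjoinBeta]
  exact fun y hy => mem_locPrime_of_mem _ 𝔮f h𝔮f (adjoinBeta_mono hDR _ hy)

include hDR in
/-- **The chart germ is a normal domain** (`R` normal with `Frac R = K`, `f'` a unit modulo `f`).
[this work] -/
theorem isIntegrallyClosed_chartGerm [IsIntegrallyClosed ↥R] [IsFractionRing ↥R K] (hf : f.Monic)
    (hu : IsUnit (AdjoinRoot.mk f (derivative f))) :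
    IsIntegrallyClosed ↥(locPrime (adjoinBeta R (f.map (algebraMap ↥D K))) 𝔮f h𝔮f) := by
  have hN : IsIntegrallyClosed ↥(liftModel R (f.map (Subalgebra.inclusion hDR).toRingHom) _
      (map_map_inclusion D f hDR)) :=
    isIntegrallyClosed_liftModel R _ _ (map_map_inclusion D f hDR) (hf.map _) (isUnit_mk_derivative_map _ hu)
  haveI : IsIntegrallyClosed ↥(adjoinBeta R (f.map (algebraMap ↥D K))) :=
    IsIntegrallyClosed.of_equiv (Subalgebra.equivOfEq _ _ (liftModel_eq_adjoinBeta R _ _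
      (map_map_inclusion D f hDR))).toRingEquiv
  exact isIntegrallyClosed_locPrime _ 𝔮f h𝔮f

open Literature.AlgebraicGeometry.Resolution in
include hDR hover in
/-- **Rationality ascends to the chart germ** (Lipman (16.5) as a hypothesis): if `D' = R_𝔮` is a
normal two-dimensional germ with a rational singularity (`R` Noetherian and normal), so is
`D'_f = (k[R ∪ {β}])_{𝔮_f}`. Stated in `Sig.L1Core`'s spelling `locPrime R 𝔮`.
[this work; conditional on the named fact `Lipman1969_16_5`] -/
theorem hasRationalSingularity_chartGerm (h16_5 : Lipman1969_16_5.{0}) [IsNoetherianRing ↥R]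
    [IsIntegrallyClosed ↥R] (hf : f.Monic) (hu : IsUnit (AdjoinRoot.mk f (derivative f)))
    (hdim : ringKrullDim ↥(locPrime R 𝔮 h𝔮) = 2) (hrat : HasRationalSingularity ↥(locPrime R 𝔮 h𝔮)) :
    HasRationalSingularity ↥(locPrime (adjoinBeta R (f.map (algebraMap ↥D K))) 𝔮f h𝔮f) := by
  have hu' := isUnit_mk_derivative_map
    (Subalgebra.inclusion (hDR.trans (le_locPrimeSubalgebra R 𝔮 h𝔮))).toRingHom hu
  have hsep : ((chartPoly D R hDR f 𝔮 h𝔮).map (residue _)).Separable := by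
    rw [← ResidueField.algebraMap_eq]
    exact separable_map_of_isUnit_mk_derivative hu'
  exact (hasRationalSingularity_fibreGerm _ _ _ (chartPoly_map D R hDR f 𝔮 h𝔮) _
    (chartGerm_le D R hDR f 𝔮 h𝔮 𝔮f h𝔮f hover) (chartGerm_frac D R hDR f 𝔮 h𝔮 𝔮f h𝔮f hover)
    (chartGerm_local D R hDR f 𝔮 h𝔮 𝔮f h𝔮f hover) h16_5 (hf.map _) hsep hdim hrat).2

include hDR in
/-- **D2′ PART 4 — `exists_chartGermData` (packaging).** For `D ≤ R ⊆ K` with `D` local, `R`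
Noetherian and normal with `Frac R = K`, `f ∈ D[X]` monic with irreducible separable reduction,
and a prime `𝔮 ⊂ R`: there is a prime `𝔮_f` of `k[R ∪ {β}]` over `𝔮` whose local ring `D'_f`
contains the upstairs thread germ `D_f`, is Noetherian and normal, has the dimension of
`D' = locPrime R 𝔮`, is regular iff `D'` is, and receives `D'` by a local flat unramified
homomorphism with finite separable residue field extension (the full bundle is `chartGerm_bundle`;
`φ` is written on the `k`-subalgebra spelling `locPrimeSubalgebra R 𝔮` of `D'`, same elements as
`locPrime R 𝔮` — cf. `locPrimeSubalgebraRingEquiv`). [this work] -/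
theorem exists_chartGermData [IsLocalRing ↥D] [IsNoetherianRing ↥R] [IsIntegrallyClosed ↥R]
    [IsFractionRing ↥R K] (hf : f.Monic) (hirr : Irreducible (f.map (residue ↥D)))
    (hsep : (f.map (residue ↥D)).Separable) (hPf : (splitPrime D f).IsPrime) :
    ∃ (𝔮f : Ideal ↥(adjoinBeta R (f.map (algebraMap ↥D K)))) (h𝔮f : 𝔮f.IsPrime)
      (φ : ↥(locPrimeSubalgebra R 𝔮 h𝔮) →+* ↥(locPrime (adjoinBeta R (f.map (algebraMap ↥D K))) 𝔮f h𝔮f)),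
      (∀ r : ↥R, toAdjoinBeta R (f.map (algebraMap ↥D K)) r ∈ 𝔮f ↔ r ∈ 𝔮) ∧
      (locPrime (splitModel D f) (splitPrime D f) hPf : Set (AdjoinRoot (f.map (algebraMap ↥D K)))) ⊆
        (locPrime (adjoinBeta R (f.map (algebraMap ↥D K))) 𝔮f h𝔮f :
          Set (AdjoinRoot (f.map (algebraMap ↥D K)))) ∧
      (∀ d, ((φ d : ↥(locPrime (adjoinBeta R (f.map (algebraMap ↥D K))) 𝔮f h𝔮f)) :
          AdjoinRoot (f.map (algebraMap ↥D K))) = algebraMap K _ (d : K)) ∧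
      IsLocalHom φ ∧ φ.Flat ∧
      (maximalIdeal ↥(locPrimeSubalgebra R 𝔮 h𝔮)).map φ =
        maximalIdeal ↥(locPrime (adjoinBeta R (f.map (algebraMap ↥D K))) 𝔮f h𝔮f) ∧
      IsNoetherianRing ↥(locPrime (adjoinBeta R (f.map (algebraMap ↥D K))) 𝔮f h𝔮f) ∧
      IsIntegrallyClosed ↥(locPrime (adjoinBeta R (f.map (algebraMap ↥D K))) 𝔮f h𝔮f) ∧
      ringKrullDim ↥(locPrime (adjoinBeta R (f.map (algebraMap ↥D K))) 𝔮f h𝔮f) =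
        ringKrullDim ↥(locPrime R 𝔮 h𝔮) ∧
      (IsRegularLocalRing ↥(locPrime (adjoinBeta R (f.map (algebraMap ↥D K))) 𝔮f h𝔮f) ↔
        IsRegularLocalRing ↥(locPrime R 𝔮 h𝔮)) := by
  have hu : IsUnit (AdjoinRoot.mk f (derivative f)) := isUnit_mk_derivative_of_separable_map hf hsep
  obtain ⟨𝔮f, h𝔮f, hover⟩ := exists_chartPrime_over D R hDR f 𝔮 h𝔮 hf
  letI := fibreGermAlgebra _ _ _ (chartPoly_map D R hDR f 𝔮 h𝔮) _
    (chartGerm_le D R hDR f 𝔮 h𝔮 𝔮f h𝔮f hover)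
  obtain ⟨hlh, hN, hfl, -, -, hm, -, -, hdim, hreg⟩ :=
    chartGerm_bundle D R hDR f 𝔮 h𝔮 𝔮f h𝔮f hover hf hu
  refine ⟨𝔮f, h𝔮f, toFibreGerm _ _ _ (chartPoly_map D R hDR f 𝔮 h𝔮) _
      (chartGerm_le D R hDR f 𝔮 h𝔮 𝔮f h𝔮f hover), hover,
    splitGerm_subset_chartGerm D R hDR f 𝔮f h𝔮f hf hirr hPf, fun d => rfl, hlh,
    RingHom.flat_algebraMap_iff.mpr hfl, hm, hN,
    isIntegrallyClosed_chartGerm D R hDR f 𝔮f h𝔮f hf hu, hdim, hreg⟩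

end ChartGerm

end Summit.ResolutionOfSingularities.ResolutionOfSingularities.Theorems.NoZeno.SplittingBase

end
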